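import Summits.QuantumFields.YangMills.Theorems.BalabanUVNodesN07ChartLogAnalytic
import Literature.MathematicalPhysics.QuantumFieldTheory.Balaban1983to89.B11Prop3Model
import Summits.QuantumFields.YangMills.Theorems.BalabanUVNodesK0Stub1RecordAveragingRightInverse
import HarnessLib

/-!
# BalabanUVNodes ∕ N07 — [15] PROPOSITION 3 COMPLETED FOR THE TRUE MULTI-LEVEL (0.4)-CONSTRAINT: the chart `D(·)` of (47) AS A MAP, its Fréchet derivative, and (73)
# «|δD(A′)∕δA′| ≤ O(1)C₃ε₃» at norm level — by lit-balaban's `B11Prop3Model.norm_fderiv_Dfix_le` on the weighted carriers of `B11Eq115Space`, with the inputs (46) (hH,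
# displayed), (44) (file `…ChartRemainderP`), `C¹` + (72) (file `…ChartLogAnalytic`) — generic carrier `P : Params` (⇒ NODE 00's T⁴ tori)

Cell `pub-ymgap`, width seat `pub-ymgap-dag-n07-w2` generation 3 (HUMAN RULING D-0149; DAG node N07 = [15] = [Balaban1985Variational]; W-SEAT START LIST §n07 item 2 = S2
«Prop. 3 at objects», last brick).  `--kind proof --supports stmt-QuantumFields-20542 --as helper` (K1⁷; count-neutral; one theorem).  CONSUMED BY NAME, nothing modified:
lit-balaban `B11Prop3Model.{Dfix, Dfix_spec, Inputs, norm_fderiv_Dfix_le}` ((49)–(55), (68)–(73): implicit function theorem + Neumann series, r08), `B11Eq115Space.NegSup`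
(`continuousLinearEquiv`, `norm_le_iff`, `norm_lt_iff`, `weight_mul_norm_apply_le`, `norm_symm_le_of_pointwise`), this seat's `N07ChartRemainderP.chartRemainder_hCd_hCq`
(hCq) and `N07ChartLogAnalytic.{analyticOnNhd_chartLog_weightedBall, contDiffOn_chartLog_weightedBall, norm_fderiv_chartLog_sub_fderiv_zero_le_weightedBall}`
(analyticity, `C¹`, (72)), the route `UnitScaleTilt`'s `Prop8Chart.chartLog ∕ collar_of_adm22`.

THE PRINT ([15] p. 289): «The formula (70) and the inequalities (71), (72) give finally the following inequality |δD(A′)(y)∕δA′(x,x′)| ≤ O(1)C₃ε₃ e^{−½δ₀d(c₋,y)}, (73) …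
PROPOSITION 3. The transformation (47) … is defined and analytic for A′ satisfying (43) with ε₃ sufficiently small … The function D(A′) satisfies the bound (55), and
its functional derivative the bound (73)».  Here (73) is read at NORM level (no kernel decay) — exactly as lit-balaban's model `B11Prop3Model` (reading (M6)) states it;
the decay form is `B11Eq73KernelDecay`, not connected here.

WHAT IS PROVED (sorry-free; no definition; axioms standard).  ★★★ `exists_chartD_hasFDerivAt` — for every torus `P`, height `k`, (2.2)-admissible nested family `D`
(`Adm22 D R′ M`, `2L ≤ R′`, `1 ≤ M`, `D.k = k`), weights `K0FlatCubeOpsTextP.IsLevWeight P k D w`, every ℂ-linear right inverse `H` of the TRUE linearisation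
`D(chartLog η D)(0)` with the weighted (46) letter `B₀` (DISPLAYED — dag k0-s1-w1's `exists_rightInverse_chartLog_of_flatH`), and every `ε > 0` with `18C₂B₀ε ≤ 1`,
`64ε ≤ R⋆` (`R⋆ = 1∕(12800ℓ²L)`, `C₂ = 960ℓL∕R⋆`, `C₃ = 3840ℓL∕R⋆`, `ℓ = (d+2)L`): there is a map `Dfun : (bonds → M_n(ℂ)) → (BondIdx D → M_n(ℂ))` such that for every
`A′` of weighted size `< ε`: (55) `‖Dfun A′ i‖ ≤ 4C₂ρ²` for every weighted size bound `ρ` of `A′`; (49) `C(A′ − H·Dfun A′) = Dfun A′` (`C := chartLog − D chartLog(0)`);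
(48) `chartLog η D (A′ − H·Dfun A′) = D(chartLog η D)(0) A′`; and **`∃ 𝔇, HasFDerivAt Dfun 𝔇 A′` with (73) `‖𝔇 W i‖ ≤ 4C₃ε·t` whenever `w 1 b·‖W b‖ ≤ t` for all `b`**;
globally `DifferentiableOn ℂ Dfun` on the weighted `ε`-ball («defined and analytic»: ℂ-differentiable — the `hWd`-type holomorphy input of the K0 heart).
`Dfun = eX ∘ Dfix Ct hop C₂ ∘ eY⁻¹` with `eY`, `eX` the weighted∕unweighted `NegSup` identifications, `Ct`, `hop` the transported `C`, `H`; the four `Inputs` are (46) ← hH,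
(44) ← hCq, `ContDiffOn ℂ 1` ← analyticity, (72) ← the Cauchy estimate, all on the radius `2c₄ = R⋆∕16`.

HONEST FRAMING: composition of kernel theorems; hH displayed; (73) at norm level; (58) and the kernel decay of (73) NOT here; nothing of [15] Sects. D–F asserted;
stub 1 ∕ K0⁷ ∕ K1⁷ NOT closed; N07 NOT discharged; counts unmoved (5∕27); one finite T⁴ programme at fixed ε — NOT continuum ∕ ℝ⁴ ∕ OS ∕ mass gap ∕ Clay: the Yang–Mills
mass gap is NOT proved by any of this; R4 closes the conditional rung `BalabanLadder.UV` only.  No `sorry`, no `def`, no `instance`, no `notation`.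

References: [15] T. Bałaban, CMP 102 (1985) 277–309 [Balaban1985Variational] ((43)–(55) pp.285–286, (63)–(73) pp.287–289, Prop. 3 p.289, (156)–(157) p.302); [B7] CMP 98
(1985) 17–51 [Balaban1985Averaging] (Props. 4–5 pp.38–42); [I] CMP 109 (1987) 249–301 [Balaban1987RG1] ((0.4) p.253).
-/

noncomputable section

open scoped BigOperators Matrix.Norms.L2Operator
open NormedSpace Metric Set

namespace Summit.QuantumFields.YangMills.BalabanUVNodes.N07ChartDDerivative

open Literature.MathematicalPhysics.QuantumFieldTheory.Balaban1983to89
open Literature.MathematicalPhysics.QuantumFieldTheory.Balaban1983to89.B6SectADomainsV1 (Domains)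
open Literature.MathematicalPhysics.QuantumFieldTheory.Balaban1983to89.B6SectAOperatorsV1 (BondIdx)
open Literature.MathematicalPhysics.QuantumFieldTheory.Balaban1983to89.B11Eq115Space (NegSup)
open Literature.MathematicalPhysics.QuantumFieldTheory.Balaban1983to89.B11Prop3Model (Dfix Inputs norm_fderiv_Dfix_le Dfix_spec)
open Summit.QuantumFields.YangMills.Theorems.FlatCubeOpsText (Adm22)
open Summit.QuantumFields.YangMills.Theorems.K0FlatCubeOpsTextP (IsLevWeight IsFlatH HSupLetterG)
open Summit.QuantumFields.YangMills.Theorems.K0Stub1RecordAveragingRightInverse (exists_rightInverse_chartLog_of_flatH)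
open Summit.QuantumFields.YangMills.Theorems.Prop8Chart (chartLog collar_of_adm22 differentiableAt_chartLog_zero)
open Summit.QuantumFields.YangMills.BalabanUVNodes.N07ChartRemainderP (chartRemainder_hCd_hCq)
open Summit.QuantumFields.YangMills.BalabanUVNodes.N07ChartLogAnalytic (analyticOnNhd_chartLog_weightedBall contDiffOn_chartLog_weightedBall
  norm_fderiv_chartLog_sub_fderiv_zero_le_weightedBall)

variable {P : Params} {n : Type*} [Fintype n] [DecidableEq n] [Nonempty n]

/-- ★★★ **[15] PROPOSITION 3 FOR THE TRUE MULTI-LEVEL (0.4)-CONSTRAINT — `D(·)` AS A DIFFERENTIABLE MAP WITH (55), (49), (48) AND (73).**  See the module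
docstring for the binders; the map is lit-balaban's `B11Prop3Model.Dfix` transported through the weighted identifications of `B11Eq115Space`, and the derivative with
its bound `4C₃ε` is `B11Prop3Model.norm_fderiv_Dfix_le` ((70)–(73)) fed with (46) (hH, displayed), (44) (`chartRemainder_hCd_hCq`), `C¹` (`contDiffOn_chartLog_weightedBall`)
and (72) (`norm_fderiv_chartLog_sub_fderiv_zero_le_weightedBall`). [cite: Balaban1985Variational, (47)-(55) pp.285-286, (70)-(73) p.289, Prop. 3 p.289, (156)-(157) p.302] -/
theorem exists_chartD_hasFDerivAt (k : ℕ) {R' M : ℕ} (hR'L : 2 * P.L ≤ R') (hM : 1 ≤ M) (D : Domains P) (hDk : D.k = k) (hAdm : Adm22 D R' M)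
    {w : ℕ → PBond P 0 → ℝ} (hw : IsLevWeight P k D w)
    (H : (BondIdx D → Matrix n n ℂ) →ₗ[ℂ] (PBond P 0 → Matrix n n ℂ))
    (hHinv : ∀ X, (fderiv ℂ (chartLog (((P.L : ℝ)⁻¹) ^ k) D : (PBond P 0 → Matrix n n ℂ) → BondIdx D → Matrix n n ℂ) 0) (H X) = X)
    {B₀ : ℝ} (hB₀ : 0 ≤ B₀)
    (hHB : ∀ (X : BondIdx D → Matrix n n ℂ) (t : ℝ), 0 ≤ t → (∀ i, ‖X i‖ ≤ t) → ∀ b, w 1 b * ‖H X b‖ ≤ B₀ * t)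
    {ε : ℝ} (hε : 0 < ε)
    (h18 : 18 * (960 * (((P.d + 2) * P.L : ℕ) : ℝ) * (P.L : ℝ) / (12800 * (((P.d + 2) * P.L : ℕ) : ℝ) ^ 2 * (P.L : ℝ))⁻¹) * B₀ * ε ≤ 1)
    (h2 : 64 * ε ≤ (12800 * (((P.d + 2) * P.L : ℕ) : ℝ) ^ 2 * (P.L : ℝ))⁻¹) :
    let η : ℝ := ((P.L : ℝ)⁻¹) ^ k
    let Rs : ℝ := (12800 * (((P.d + 2) * P.L : ℕ) : ℝ) ^ 2 * (P.L : ℝ))⁻¹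
    let C₂ : ℝ := 960 * (((P.d + 2) * P.L : ℕ) : ℝ) * (P.L : ℝ) / Rs
    let C₃ : ℝ := 3840 * (((P.d + 2) * P.L : ℕ) : ℝ) * (P.L : ℝ) / Rs
    let Qlin := (fderiv ℂ (chartLog η D : (PBond P 0 → Matrix n n ℂ) → BondIdx D → Matrix n n ℂ) 0)
    ∃ Dfun : (PBond P 0 → Matrix n n ℂ) → (BondIdx D → Matrix n n ℂ),
      DifferentiableOn ℂ Dfun {A' : PBond P 0 → Matrix n n ℂ | ∀ b, w 1 b * ‖A' b‖ < ε} ∧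
      ∀ A' : PBond P 0 → Matrix n n ℂ, (∀ b, w 1 b * ‖A' b‖ < ε) →
        (∀ (ρ : ℝ), 0 ≤ ρ → (∀ b, w 1 b * ‖A' b‖ ≤ ρ) → ∀ i, ‖Dfun A' i‖ ≤ 4 * C₂ * ρ ^ 2) ∧
        chartLog η D (A' - H (Dfun A')) - Qlin (A' - H (Dfun A')) = Dfun A' ∧
        chartLog η D (A' - H (Dfun A')) = Qlin A' ∧
        ∃ 𝔇 : (PBond P 0 → Matrix n n ℂ) →L[ℂ] (BondIdx D → Matrix n n ℂ), HasFDerivAt Dfun 𝔇 A' ∧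
          ∀ (W : PBond P 0 → Matrix n n ℂ) (t : ℝ), 0 ≤ t → (∀ b, w 1 b * ‖W b‖ ≤ t) → ∀ i, ‖𝔇 W i‖ ≤ 4 * C₃ * ε * t := by
  intro η Rs C₂ C₃ Qlin
  -- positivity of the letters
  have hL0 : (0 : ℝ) < P.L := by exact_mod_cast P.L_pos
  have hℓ1 : (1 : ℝ) ≤ (((P.d + 2) * P.L : ℕ) : ℝ) := by
    exact_mod_cast Nat.one_le_iff_ne_zero.mpr (Nat.mul_ne_zero (by omega) (by have := P.hL.2; omega))
  have hden : 0 < 12800 * (((P.d + 2) * P.L : ℕ) : ℝ) ^ 2 * (P.L : ℝ) := by positivity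
  have hRs0 : 0 < Rs := inv_pos.mpr hden
  have hRs1 : 12800 * (((P.d + 2) * P.L : ℕ) : ℝ) ^ 2 * (P.L : ℝ) * Rs ≤ 1 := by
    show 12800 * (((P.d + 2) * P.L : ℕ) : ℝ) ^ 2 * (P.L : ℝ) * (12800 * (((P.d + 2) * P.L : ℕ) : ℝ) ^ 2 * (P.L : ℝ))⁻¹ ≤ 1
    rw [mul_inv_cancel₀ hden.ne']
  have hC₂ : 0 ≤ C₂ := by show 0 ≤ 960 * (((P.d + 2) * P.L : ℕ) : ℝ) * (P.L : ℝ) / Rs; positivity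
  have hC₃ : 0 ≤ C₃ := by show 0 ≤ 3840 * (((P.d + 2) * P.L : ℕ) : ℝ) * (P.L : ℝ) / Rs; positivity
  have hwpos : ∀ b, 0 < w 1 b := fun b => by rw [hw 1 b, pow_one]; positivity
  have hRM : 2 * P.L ≤ R' * M + 1 := by have : R' ≤ R' * M := Nat.le_mul_of_pos_right R' hM; omega
  have hcollar := collar_of_adm22 D hAdm hRM
  -- the letters of files `…ChartRemainderP` (hCq) and `…ChartLogAnalytic` (analyticity, ContDiff, (72))
  obtain ⟨-, hCq⟩ := chartRemainder_hCd_hCq (𝔸 := Matrix n n ℂ) k hR'L hM D hDk hAdm hw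
  have han := analyticOnNhd_chartLog_weightedBall (𝔸 := Matrix n n ℂ) k D hDk hcollar hw hRs1
  have hcd := contDiffOn_chartLog_weightedBall (𝔸 := Matrix n n ℂ) (m := 1) k D hDk hcollar hw hRs1
  -- the weighted carriers
  haveI hFw : Fact (∀ b : PBond P 0, 0 < w 1 b) := ⟨hwpos⟩
  haveI hF1 : Fact (∀ _ : BondIdx D, 0 < (1 : ℝ)) := ⟨fun _ => one_pos⟩
  let eY := NegSup.continuousLinearEquiv ℂ (V := Matrix n n ℂ) (w 1)
  let eX := NegSup.continuousLinearEquiv ℂ (V := Matrix n n ℂ) (fun _ : BondIdx D => (1 : ℝ))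
  have heY : ∀ Y b, eY Y b = NegSup.equiv (w 1) (Matrix n n ℂ) Y b := fun _ _ => rfl
  have heX : ∀ X i, eX X i = NegSup.equiv (fun _ : BondIdx D => (1 : ℝ)) (Matrix n n ℂ) X i := fun _ _ => rfl
  -- pointwise sizes vs the weighted norms
  have hYpt : ∀ (Y : NegSup (w 1) (Matrix n n ℂ)) b, w 1 b * ‖eY Y b‖ ≤ ‖Y‖ := fun Y b => NegSup.weight_mul_norm_apply_le Y b
  have hXpt : ∀ (X : NegSup (fun _ : BondIdx D => (1 : ℝ)) (Matrix n n ℂ)) i, ‖eX X i‖ ≤ ‖X‖ := fun X i => by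
    have h := NegSup.weight_mul_norm_apply_le (w := fun _ : BondIdx D => (1 : ℝ)) X i
    rw [one_mul] at h
    exact h
  -- the nonlinear part `C` and the transported data
  set C : (PBond P 0 → Matrix n n ℂ) → (BondIdx D → Matrix n n ℂ) := fun Y => chartLog η D Y - Qlin Y with hC
  let Ct : NegSup (w 1) (Matrix n n ℂ) → NegSup (fun _ : BondIdx D => (1 : ℝ)) (Matrix n n ℂ) := fun Y => eX.symm (C (eY Y))
  let hop : NegSup (fun _ : BondIdx D => (1 : ℝ)) (Matrix n n ℂ) →ₗ[ℂ] NegSup (w 1) (Matrix n n ℂ) :=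
    { toFun := fun X => eY.symm (H (eX X))
      map_add' := fun X X' => by simp only [map_add]
      map_smul' := fun z X => by simp only [map_smul, RingHom.id_apply] }
  have hhop_apply : ∀ X, hop X = eY.symm (H (eX X)) := fun _ => rfl
  -- (46): the transported `H` is bounded by `B₀`
  have hnormH : ∀ X, ‖hop X‖ ≤ B₀ * ‖X‖ := fun X => by
    rw [hhop_apply]
    refine (NegSup.norm_le_iff (mul_nonneg hB₀ (norm_nonneg _))).2 fun b => ?_
    have h := hHB (eX X) ‖X‖ (norm_nonneg _) (hXpt X) b
    have hid : NegSup.equiv (w 1) (Matrix n n ℂ) (eY.symm (H (eX X))) b = H (eX X) b := by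
      show eY (eY.symm (H (eX X))) b = H (eX X) b
      rw [ContinuousLinearEquiv.apply_symm_apply]
    rw [hid]; exact h
  -- (44): the quadratic letter in the weighted norms (radius `Rs/16 < Rs/4`)
  have hquad : ∀ Y : NegSup (w 1) (Matrix n n ℂ), ‖Y‖ < 2 * (Rs / 32) → ‖Ct Y‖ ≤ C₂ * ‖Y‖ ^ 2 := fun Y hY => by
    refine (NegSup.norm_le_iff (by positivity)).2 fun i => ?_
    rw [one_mul]
    have hlt : ‖Y‖ < Rs / 4 := by linarith
    have h := hCq (eY Y) ‖Y‖ hlt (hYpt Y) i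
    have hid : NegSup.equiv (fun _ : BondIdx D => (1 : ℝ)) (Matrix n n ℂ) (Ct Y) i = C (eY Y) i := by
      show eX (eX.symm (C (eY Y))) i = C (eY Y) i
      rw [ContinuousLinearEquiv.apply_symm_apply]
    rw [hid]; exact h
  -- the domain `‖Y‖ < Rs/16` is mapped into the weighted ball of radius `Rs`
  have hmaps : ∀ Y : NegSup (w 1) (Matrix n n ℂ), ‖Y‖ < 2 * (Rs / 32) → ∀ b, w 1 b * ‖eY Y b‖ < Rs := fun Y hY b =>
    (hYpt Y b).trans_lt (by linarith)
  -- `C` is `C¹` and analytic on the weighted ball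
  have hCcd : ContDiffOn ℂ 1 C {Y : PBond P 0 → Matrix n n ℂ | ∀ b, w 1 b * ‖Y b‖ < Rs} :=
    hcd.sub Qlin.contDiff.contDiffOn
  have hcontDiff : ContDiffOn ℂ 1 Ct {Y : NegSup (w 1) (Matrix n n ℂ) | ‖Y‖ < 2 * (Rs / 32)} := by
    refine eX.symm.contDiff.comp_contDiffOn (hCcd.comp eY.contDiff.contDiffOn fun Y hY => ?_)
    exact hmaps Y hY
  -- (72): the derivative of `Ct` is `C₃`-Lipschitz at the origin
  have hCdiff : ∀ Y : NegSup (w 1) (Matrix n n ℂ), ‖Y‖ < 2 * (Rs / 32) →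
      HasFDerivAt C ((fderiv ℂ (chartLog η D : (PBond P 0 → Matrix n n ℂ) → BondIdx D → Matrix n n ℂ) (eY Y)) - Qlin) (eY Y) :=
    fun Y hY => ((han (eY Y) (hmaps Y hY)).differentiableAt.hasFDerivAt).sub Qlin.hasFDerivAt
  have hCt_deriv : ∀ Y : NegSup (w 1) (Matrix n n ℂ), ‖Y‖ < 2 * (Rs / 32) →
      HasFDerivAt Ct ((eX.symm : (BondIdx D → Matrix n n ℂ) →L[ℂ] NegSup (fun _ : BondIdx D => (1 : ℝ)) (Matrix n n ℂ)).comp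
        ((((fderiv ℂ (chartLog η D : (PBond P 0 → Matrix n n ℂ) → BondIdx D → Matrix n n ℂ) (eY Y)) - Qlin)).comp
          (eY : NegSup (w 1) (Matrix n n ℂ) →L[ℂ] (PBond P 0 → Matrix n n ℂ)))) Y :=
    fun Y hY => eX.symm.hasFDerivAt.comp Y ((hCdiff Y hY).comp Y eY.hasFDerivAt)
  have hderiv_le : ∀ Y : NegSup (w 1) (Matrix n n ℂ), ‖Y‖ < 2 * (Rs / 32) → ‖fderiv ℂ Ct Y‖ ≤ C₃ * ‖Y‖ := fun Y hY => by
    rw [(hCt_deriv Y hY).fderiv]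
    refine ContinuousLinearMap.opNorm_le_bound _ (by positivity) fun W => ?_
    rw [ContinuousLinearMap.comp_apply, ContinuousLinearMap.comp_apply]
    refine (NegSup.norm_le_iff (by positivity)).2 fun i => ?_
    rw [one_mul]
    have h8 : 8 * ‖Y‖ ≤ Rs := by linarith
    have h72 := norm_fderiv_chartLog_sub_fderiv_zero_le_weightedBall (𝔸 := Matrix n n ℂ) k D hDk hcollar hw hRs1 hRs0 (eY Y) (eY W)
      (norm_nonneg Y) h8 (norm_nonneg W) (hYpt Y) (hYpt W) i
    have heq : NegSup.equiv (fun _ : BondIdx D => (1 : ℝ)) (Matrix n n ℂ)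
        ((eX.symm : (BondIdx D → Matrix n n ℂ) →L[ℂ] _) ((((fderiv ℂ (chartLog η D : (PBond P 0 → Matrix n n ℂ) → BondIdx D → Matrix n n ℂ) (eY Y)) - Qlin))
          ((eY : NegSup (w 1) (Matrix n n ℂ) →L[ℂ] _) W))) i =
        (fderiv ℂ (chartLog η D : (PBond P 0 → Matrix n n ℂ) → BondIdx D → Matrix n n ℂ) (eY Y)) (eY W) i -
          (fderiv ℂ (chartLog η D : (PBond P 0 → Matrix n n ℂ) → BondIdx D → Matrix n n ℂ) 0) (eY W) i := rfl
    rw [heq]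
    calc _ ≤ 3840 * (((P.d + 2) * P.L : ℕ) : ℝ) * (P.L : ℝ) / Rs * ‖W‖ * ‖Y‖ := h72
      _ = C₃ * ‖Y‖ * ‖W‖ := by ring
  have hin : Inputs Ct hop C₂ C₃ B₀ (Rs / 32) := ⟨hnormH, hquad, hcontDiff, hderiv_le⟩
  have h2'' : 64 * ε ≤ Rs := h2
  have h2' : 2 * ε ≤ Rs / 32 := by linarith
  -- the chart map, read back on plain functions
  have hball : ∀ A' : PBond P 0 → Matrix n n ℂ, (∀ b, w 1 b * ‖A' b‖ < ε) → ‖eY.symm A'‖ < ε := fun A' hA' =>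
    (NegSup.norm_lt_iff hε).2 fun b => by
      have hid : NegSup.equiv (w 1) (Matrix n n ℂ) (eY.symm A') b = A' b := by
        show eY (eY.symm A') b = A' b
        rw [ContinuousLinearEquiv.apply_symm_apply]
      rw [hid]; exact hA' b
  have hderivAt : ∀ A' : PBond P 0 → Matrix n n ℂ, (∀ b, w 1 b * ‖A' b‖ < ε) →
      HasFDerivAt (fun A => eX (Dfix Ct hop C₂ (eY.symm A)))
        ((eX : NegSup (fun _ : BondIdx D => (1 : ℝ)) (Matrix n n ℂ) →L[ℂ] (BondIdx D → Matrix n n ℂ)).comp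
          ((fderiv ℂ (Dfix Ct hop C₂) (eY.symm A')).comp (eY.symm : (PBond P 0 → Matrix n n ℂ) →L[ℂ] NegSup (w 1) (Matrix n n ℂ)))) A' :=
    fun A' hA' => (eX : NegSup (fun _ : BondIdx D => (1 : ℝ)) (Matrix n n ℂ) →L[ℂ] (BondIdx D → Matrix n n ℂ)).hasFDerivAt.comp A'
      ((norm_fderiv_Dfix_le hin hC₂ hC₃ hB₀ hε h18 h2' (hball A' hA')).1.comp A' eY.symm.hasFDerivAt)
  refine ⟨fun A => eX (Dfix Ct hop C₂ (eY.symm A)), fun A' hA' => (hderivAt A' hA').differentiableAt.differentiableWithinAt, fun A' hA' => ?_⟩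
  have hY₀ : ‖eY.symm A'‖ < ε := hball A' hA'
  obtain ⟨hD, hDle⟩ := norm_fderiv_Dfix_le hin hC₂ hC₃ hB₀ hε h18 h2' hY₀
  -- (55) at every admissible size, and the fixed-point equation (49), from the contraction at that size
  have h9 : 9 * C₂ * B₀ * ε < 1 := by nlinarith [mul_nonneg (mul_nonneg hC₂ hB₀) hε.le]
  have h3R : 3 * ε ≤ 2 * (Rs / 32) := by linarith
  have hspec := Dfix_spec (Ct := Ct) (hop := hop) hin.quadAnalytic hC₂ hB₀ hnormH h9 h3R hY₀
  have hfixC : C (A' - H (eX (Dfix Ct hop C₂ (eY.symm A')))) = eX (Dfix Ct hop C₂ (eY.symm A')) := by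
    have h := congrArg eX hspec.2
    have hL : eX (Ct (eY.symm A' - hop (Dfix Ct hop C₂ (eY.symm A')))) = C (A' - H (eX (Dfix Ct hop C₂ (eY.symm A')))) := by
      show eX (eX.symm (C (eY (eY.symm A' - eY.symm (H (eX (Dfix Ct hop C₂ (eY.symm A')))))))) = _
      rw [ContinuousLinearEquiv.apply_symm_apply, map_sub, ContinuousLinearEquiv.apply_symm_apply, ContinuousLinearEquiv.apply_symm_apply]
    rw [hL] at h
    exact h
  refine ⟨fun ρ hρ hA'ρ i => ?_, hfixC, ?_, ⟨(eX : NegSup (fun _ : BondIdx D => (1 : ℝ)) (Matrix n n ℂ) →L[ℂ] (BondIdx D → Matrix n n ℂ)).comp ((fderiv ℂ (Dfix Ct hop C₂) (eY.symm A')).comp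
      (eY.symm : (PBond P 0 → Matrix n n ℂ) →L[ℂ] NegSup (w 1) (Matrix n n ℂ))), ?_, fun W t ht hW i => ?_⟩⟩
  · -- (55) at size `ρ`
    have hY₀ρ : ‖eY.symm A'‖ ≤ ρ := NegSup.norm_symm_le_of_pointwise (w := w 1) hρ hA'ρ
    have h1 : ‖Dfix Ct hop C₂ (eY.symm A')‖ ≤ 4 * C₂ * ρ ^ 2 :=
      hspec.1.trans (mul_le_mul_of_nonneg_left (pow_le_pow_left₀ (norm_nonneg _) hY₀ρ 2) (by positivity))
    exact (hXpt _ i).trans h1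
  · -- (48): `chartLog (A′ − HD) = Qlin (A′ − HD) + C (A′ − HD) = Qlin A′ − D + D`
    have h := hfixC
    simp only [hC] at h
    have hQ : Qlin (A' - H (eX (Dfix Ct hop C₂ (eY.symm A')))) = Qlin A' - eX (Dfix Ct hop C₂ (eY.symm A')) := by
      rw [map_sub, hHinv]
    rw [hQ] at h
    -- h : chartLog … − (Qlin A' − D) = D
    have := sub_eq_iff_eq_add.mp h
    rw [this]; abel
  · -- the derivative of the composite `eX ∘ Dfix ∘ eY⁻¹`
    exact hderivAt A' hA'
  · -- (73): `‖𝔇 W i‖ ≤ ‖𝔇₀‖·‖eY⁻¹ W‖ ≤ 4C₃ε·t`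
    rw [ContinuousLinearMap.comp_apply, ContinuousLinearMap.comp_apply]
    have hWn : ‖(eY.symm : (PBond P 0 → Matrix n n ℂ) →L[ℂ] NegSup (w 1) (Matrix n n ℂ)) W‖ ≤ t := by
      rw [ContinuousLinearEquiv.coe_coe]
      exact NegSup.norm_symm_le_of_pointwise (w := w 1) ht hW
    calc ‖(eX : NegSup (fun _ : BondIdx D => (1 : ℝ)) (Matrix n n ℂ) →L[ℂ] (BondIdx D → Matrix n n ℂ)) ((fderiv ℂ (Dfix Ct hop C₂) (eY.symm A')) ((eY.symm : (PBond P 0 → Matrix n n ℂ) →L[ℂ] NegSup (w 1) (Matrix n n ℂ)) W)) i‖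
        ≤ ‖(fderiv ℂ (Dfix Ct hop C₂) (eY.symm A')) ((eY.symm : (PBond P 0 → Matrix n n ℂ) →L[ℂ] NegSup (w 1) (Matrix n n ℂ)) W)‖ := hXpt _ i
      _ ≤ ‖fderiv ℂ (Dfix Ct hop C₂) (eY.symm A')‖ * ‖(eY.symm : (PBond P 0 → Matrix n n ℂ) →L[ℂ] NegSup (w 1) (Matrix n n ℂ)) W‖ := ContinuousLinearMap.le_opNorm _ _
      _ ≤ (4 * C₃ * ε) * t := mul_le_mul hDle hWn (norm_nonneg _) (by positivity)
      _ = 4 * C₃ * ε * t := by ring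

/-! ## §3  With dag k0-s1-w1's right inverse: [15] Proposition 3 for the TRUE constraint with ONLY P2's flat-`H` letters displayed -/

/-- ★★★ **[15] PROPOSITION 3 FOR THE TRUE MULTI-LEVEL (0.4)-CONSTRAINT FROM P2's FLAT `H`** — the seam with dag k0-s1-w1 g3 closed BY NAME: their
`K0Stub1RecordAveragingRightInverse.exists_rightInverse_chartLog_of_flatH` supplies the right inverse `H` of the TRUE linearisation with the (46) letter
`B₀·(1+2ℓ)(1+2ℓ+2ℓL)` from P2's canonical flat operator `H₀` (`IsFlatH P k D H₀`, guarded letter `HSupLetterG P k D w H₀ B₀` — dag k0-s1-w3's generic schemas, whose content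
is lit-balaban's Cor. 2.8), and §1 gives the chart map `D(·)` with (55), (49), (48), its Fréchet derivative and (73).  Displayed after this theorem: ONLY the P2 letters of `H₀`
and the `ε`-window. [cite: Balaban1985Variational, (45)-(47) p.285, (55) p.286, (70)-(73) p.289, Prop. 3 p.289, (157) p.302; Balaban1984PropagatorsII, (2.35) p.228, Cor. 2.8 p.249] -/
theorem exists_chartD_hasFDerivAt_of_flatH (k : ℕ) {R' M : ℕ} (hR'L : 2 * P.L ≤ R') (hM : 1 ≤ M) (D : Domains P) (hDk : D.k = k) (hAdm : Adm22 D R' M)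
    {w : ℕ → PBond P 0 → ℝ} (hw : IsLevWeight P k D w) (H₀ : (BondIdx D → ℝ) →ₗ[ℝ] (PBond P 0 → ℝ)) (hH₀ : IsFlatH P k D H₀)
    {B₀ : ℝ} (hB₀ : 0 ≤ B₀) (hsup : HSupLetterG P k D w H₀ B₀) {ε : ℝ} (hε : 0 < ε)
    (h18 : 18 * (960 * (((P.d + 2) * P.L : ℕ) : ℝ) * (P.L : ℝ) / (12800 * (((P.d + 2) * P.L : ℕ) : ℝ) ^ 2 * (P.L : ℝ))⁻¹) *
      (B₀ * ((1 + 2 * ((P.d + 2) * P.L : ℕ)) * (1 + 2 * ((P.d + 2) * P.L : ℕ) + 2 * ((P.d + 2) * P.L : ℕ) * P.L))) * ε ≤ 1)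
    (h2 : 64 * ε ≤ (12800 * (((P.d + 2) * P.L : ℕ) : ℝ) ^ 2 * (P.L : ℝ))⁻¹) :
    let η : ℝ := ((P.L : ℝ)⁻¹) ^ k
    let Rs : ℝ := (12800 * (((P.d + 2) * P.L : ℕ) : ℝ) ^ 2 * (P.L : ℝ))⁻¹
    let C₂ : ℝ := 960 * (((P.d + 2) * P.L : ℕ) : ℝ) * (P.L : ℝ) / Rs
    let C₃ : ℝ := 3840 * (((P.d + 2) * P.L : ℕ) : ℝ) * (P.L : ℝ) / Rs
    let Qlin := (fderiv ℂ (chartLog η D : (PBond P 0 → Matrix n n ℂ) → BondIdx D → Matrix n n ℂ) 0)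
    ∃ (H : (BondIdx D → Matrix n n ℂ) →ₗ[ℂ] (PBond P 0 → Matrix n n ℂ)) (Dfun : (PBond P 0 → Matrix n n ℂ) → (BondIdx D → Matrix n n ℂ)),
      (∀ X, Qlin (H X) = X) ∧
      DifferentiableOn ℂ Dfun {A' : PBond P 0 → Matrix n n ℂ | ∀ b, w 1 b * ‖A' b‖ < ε} ∧
      ∀ A' : PBond P 0 → Matrix n n ℂ, (∀ b, w 1 b * ‖A' b‖ < ε) →
        (∀ (ρ : ℝ), 0 ≤ ρ → (∀ b, w 1 b * ‖A' b‖ ≤ ρ) → ∀ i, ‖Dfun A' i‖ ≤ 4 * C₂ * ρ ^ 2) ∧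
        chartLog η D (A' - H (Dfun A')) - Qlin (A' - H (Dfun A')) = Dfun A' ∧
        chartLog η D (A' - H (Dfun A')) = Qlin A' ∧
        ∃ 𝔇 : (PBond P 0 → Matrix n n ℂ) →L[ℂ] (BondIdx D → Matrix n n ℂ), HasFDerivAt Dfun 𝔇 A' ∧
          ∀ (W : PBond P 0 → Matrix n n ℂ) (t : ℝ), 0 ≤ t → (∀ b, w 1 b * ‖W b‖ ≤ t) → ∀ i, ‖𝔇 W i‖ ≤ 4 * C₃ * ε * t := by
  intro η Rs C₂ C₃ Qlin
  have hRM : 2 * P.L ≤ R' * M + 1 := by have : R' ≤ R' * M := Nat.le_mul_of_pos_right R' hM; omega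
  obtain ⟨H, hHinv, hHB⟩ := exists_rightInverse_chartLog_of_flatH (n := n) k D hDk hAdm hRM w hw H₀ hH₀ hB₀ hsup
  have hB₀' : 0 ≤ B₀ * ((1 + 2 * ((P.d + 2) * P.L : ℕ)) * (1 + 2 * ((P.d + 2) * P.L : ℕ) + 2 * ((P.d + 2) * P.L : ℕ) * P.L)) := by positivity
  obtain ⟨Dfun, hdiff, hDfun⟩ := exists_chartD_hasFDerivAt k hR'L hM D hDk hAdm hw H hHinv hB₀' hHB hε h18 h2
  exact ⟨H, Dfun, hHinv, hdiff, hDfun⟩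

/-- **THE `ε`-WINDOW OF (73) IS INHABITED** (A6): for `C₂, B₀ ≥ 0` and `R > 0`, `ε := min (R∕64) (1∕(18C₂B₀ + 1))` is positive with `18C₂B₀ε ≤ 1` and `64ε ≤ R`
(print: «ε₃ sufficiently small», p.289). [cite: Balaban1985Variational, Prop. 3 p.289, (54) p.286] -/
theorem exists_eps_chartDDeriv {C₂ B₀ R : ℝ} (hC₂ : 0 ≤ C₂) (hB₀ : 0 ≤ B₀) (hR : 0 < R) :
    ∃ ε : ℝ, 0 < ε ∧ 18 * C₂ * B₀ * ε ≤ 1 ∧ 64 * ε ≤ R := by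
  refine ⟨min (R / 64) (1 / (18 * C₂ * B₀ + 1)), lt_min (by positivity) (by positivity), ?_, ?_⟩
  · have h1 : min (R / 64) (1 / (18 * C₂ * B₀ + 1)) ≤ 1 / (18 * C₂ * B₀ + 1) := min_le_right _ _
    have h2 : 18 * C₂ * B₀ * (1 / (18 * C₂ * B₀ + 1)) ≤ 1 := by
      rw [mul_one_div, div_le_one (by positivity)]; linarith
    exact le_trans (mul_le_mul_of_nonneg_left h1 (by positivity)) h2
  · have : min (R / 64) (1 / (18 * C₂ * B₀ + 1)) ≤ R / 64 := min_le_left _ _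
    linarith

end Summit.QuantumFields.YangMills.BalabanUVNodes.N07ChartDDerivative

end
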